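import Mathlib
import Summits.Ventures.HodgeRepro.Tier4.Target
import Summits.Ventures.HodgeRepro.Tier4.Common.TargetBall
import Summits.Ventures.HodgeRepro.Tier4.Common.TargetCalculus
import Summits.Ventures.HodgeRepro.Tier4.Common.AutForms
import Summits.Ventures.HodgeRepro.Tier4.Line3.KMDatum
import Summits.Ventures.HodgeRepro.Tier4.Line3.KMDatumS
import Summits.Ventures.HodgeRepro.Tier4.Line3.Defs
import Summits.Ventures.HodgeRepro.Tier4.Line3.HeckeEquivarianceLemmas
import Summits.Ventures.HodgeRepro.Tier4.Line3.BallChangeOfVariables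

/-!
# Tier4/Line3/KernelEquivariance — `U(H)`-invariance of the archimedean kernel integral (L3.6a, step R3; v0.14 datum)

Blind re-derivation cell `pub-hodge-repro`, Tier 4 «PROVE THE STEP» (README §9–§10), LINE L3, seat t4-L3-p1 (prover);
support (S4e) of L3.6a `term_main_unfold` (lead S12253): the step (R3) of the skeleton's docstring —
`∫_𝔹 kernel(g • x) = ∫_𝔹 kernel(x)` for `g ∈ U(H)(E′)`.

CONTENT.  For a datum `D : X.ThetaData` the clause `D.equiv` says that `datumS D.Φ` transforms as a `(1,0)`-form under
`M ∈ U(2,1)`: `datumS Φ y z = Jac(actM M)(z)ᵀ · datumS Φ (M y) (actM M z)`.  Hence (`wedge_datum_equiv`)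
`Φ(y₀) ∧ Φ(y₁)(z) = jacDetMap (actM M) z · (Φ(M y₀) ∧ Φ(M y₁))(actM M z)` and (`kernel_equiv`)
`kernel Φ x z = normSq (jacDetMap (actM M) z) · kernel Φ (g • x) (actM M z)` for `M = M(g)`, `g ∈ U(H)(E′)`
(`ballCoord (g x_j) = M(g) · ballCoord x_j`, t4-L3-p2's `ballCoord_mulVec`; `M(g) ∈ U(2,1)`, `toBallMat_J_of_unitary`).
The change of variables `integral_ball_actM` (S1) then gives `integral_kernel_mulVec`:
`∫ z in ball, kernel Φ (g • x) z = ∫ z in ball, kernel Φ x z`.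

Nothing here asserts anything about the truth of (P); HC_CM is NOT proved by anyone in this repository.
-/

set_option autoImplicit false

noncomputable section

namespace Summit.Ventures.HodgeRepro.Tier4.Line3

open Summit.Ventures.HodgeRepro.Tier4
open Matrix MeasureTheory
open scoped ComplexConjugate
open HeckeEquivariance

/-- The wedge of two vectors transformed by the same `2×2` matrix `A` (entries `A l k`, acting as `a ↦ (Σ_k a k A l k)_l`)
is `det A` times the wedge. -/
theorem wedge_matrix (A : Fin 2 → Fin 2 → ℂ) (a b : Fin 2 → ℂ) :
    wedge (fun l => ∑ k, a k * A l k) (fun l => ∑ k, b k * A l k) =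
      (A 0 0 * A 1 1 - A 0 1 * A 1 0) * wedge a b := by
  simp only [wedge, Fin.sum_univ_two]
  ring

namespace T4Data

variable (X : T4Data)

/-- **THE WEDGE OF THE DATUM TRANSFORMS BY THE JACOBIAN** (from `ThetaData.equiv`): for `M ∈ U(2,1)` and `z ∈ ball`,
`wedge (Φ(y₀, z)) (Φ(y₁, z)) = jacDetMap (actM M) z · wedge (Φ(M y₀, M z)) (Φ(M y₁, M z))`. -/
theorem wedge_datum_equiv (D : X.ThetaData) {M : Matrix (Fin 3) (Fin 3) ℂ}
    (hM : IsUnitaryOf (starRingAut : ℂ ≃+* ℂ) J M) (y₀ y₁ : Fin 3 → ℂ) {z : Fin 2 → ℂ} (hz : z ∈ ball) :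
    wedge (datumS D.Φ y₀ z) (datumS D.Φ y₁ z) =
      jacDetMap (actM M) z *
        wedge (datumS D.Φ (M *ᵥ y₀) (actM M z)) (datumS D.Φ (M *ᵥ y₁) (actM M z)) := by
  have h0 : datumS D.Φ y₀ z = fun l => ∑ k, datumS D.Φ (M *ᵥ y₀) (actM M z) k * pd l (fun w => actM M w k) z :=
    funext fun l => (D.equiv M hM y₀ z hz l).symm
  have h1 : datumS D.Φ y₁ z = fun l => ∑ k, datumS D.Φ (M *ᵥ y₁) (actM M z) k * pd l (fun w => actM M w k) z :=
    funext fun l => (D.equiv M hM y₁ z hz l).symm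
  rw [h0, h1, wedge_matrix (fun l k => pd l (fun w => actM M w k) z)]
  simp only [jacDetMap, wedge]
  ring

/-- **THE KERNEL TRANSFORMS BY `|det Jac|²`**: for `g ∈ U(H)(E′)`, `M = M(g)` and `z ∈ ball`,
`kernel Φ x z = normSq (jacDetMap (actM M) z) · kernel Φ (g • x) (actM M z)`. -/
theorem kernel_equiv (D : X.ThetaData) {g : Matrix (Fin 3) (Fin 3) X.E} (hg : IsUnitaryOf X.c X.H g)
    (x : X.Tuple) {z : Fin 2 → ℂ} (hz : z ∈ ball) :
    X.kernel D.Φ x z =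
      (Complex.normSq (jacDetMap (actM (toBallMat X.τ₀ X.C g)) z) : ℂ) *
        X.kernel D.Φ (fun j => g *ᵥ x j) (actM (toBallMat X.τ₀ X.C g) z) := by
  have hM : IsUnitaryOf (starRingAut : ℂ ≃+* ℂ) J (toBallMat X.τ₀ X.C g) :=
    isUnitaryOf_J_of_conjTranspose (toBallMat_J_of_unitary X hg)
  simp only [T4Data.kernel, ballCoord_mulVec X]
  rw [X.wedge_datum_equiv D hM (X.ballCoord (x 0)) (X.ballCoord (x 1)) hz,
    X.wedge_datum_equiv D hM (X.ballCoord (x 2)) (X.ballCoord (x 3)) hz, map_mul, ← Complex.mul_conj]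
  ring

/-- **`U(H)`-INVARIANCE OF THE KERNEL INTEGRAL** (step R3 of L3.6a): `∫_𝔹 kernel(g • x) = ∫_𝔹 kernel(x)` for
`g ∈ U(H)(E′)`. -/
theorem integral_kernel_mulVec (D : X.ThetaData) {g : Matrix (Fin 3) (Fin 3) X.E} (hg : IsUnitaryOf X.c X.H g)
    (x : X.Tuple) :
    ∫ z in ball, X.kernel D.Φ (fun j => g *ᵥ x j) z = ∫ z in ball, X.kernel D.Φ x z := by
  have hM : (toBallMat X.τ₀ X.C g)ᴴ * J * toBallMat X.τ₀ X.C g = J := toBallMat_J_of_unitary X hg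
  rw [integral_ball_actM hM (fun w => X.kernel D.Φ (fun j => g *ᵥ x j) w)]
  refine setIntegral_congr_fun isOpen_ball.measurableSet fun z hz => ?_
  exact (X.kernel_equiv D hg x hz).symm

end T4Data

end Summit.Ventures.HodgeRepro.Tier4.Line3

end
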